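import Summits.KontsevichZagierPeriods.KontsevichZagierPeriods.Theorems.RootDecompWalshStrataConicHeight

/-!
# Root decomposition & Walsh strata — the conic-wall terminal, part 3: degenerate strata (gen 8, §36.6–36.7)

Route `RootDecompWalshStrata`, leaf `QuadricBakerDescent` (stmt-27597), residual R-E2 (NODE.md, decomp-kz-lens-4).
Parts 1–2 (`…ConicClass`, `…ConicHeight`) treat the conic-wall height terminal on the GENERIC stratum
(`δ = δe·Y² + δf·Y + δg` a non-degenerate quadratic).  This part: (§36.6) a generic splitter
`InBaker.abs_of_signed` (the absolute value of a semialgebraic factor is removed by ONE domain split) and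
the LINEAR-RADICAND stratum `δe = 0, δf ≠ 0` — after `InBaker.peel_rat` the term `N₁/(R₄√δ) = (N₁/(R₄δ))·√δ`
is the landed `InBaker.linear_factor` (`ConicWall.terminal_identity` holds verbatim) — packaged as
`InBaker.conic_height_lin`; (§36.7) the stratum `k = aκ₀ − l₁² = 0`, where the wall is LINEAR in `X`, the
branch `X(Y) = (aκ₁Y² + c − L²)/(2l₁L)` is RATIONAL and so is the height integrand up to one sign
(`InBaker.conic_height_k0`). [KontsevichZagier2001 §1.2; Euler 1768; this node]
-/

noncomputable section

open Set MeasureTheory Literature.NumberTheory.Transcendental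
open Literature.ModelTheory.ExponentialFields (IsSemialgebraic IsSemialgebraic)

namespace Summit.KontsevichZagierPeriods.RootDecompWalshStrata.ConicDescent

/-! #### 36.6 The sign splitter and the linear-radicand stratum -/

/-- **SIGN SPLITTER.**  If `r.integrand = F·|G|` on the domain with `G` semialgebraic, and every
representation on a semialgebraic subset of the domain with integrand `s·F·G` (`s = ±1`) is in `InBaker`,
then so is `r`: split the domain along `{G < 0}` (`InBaker.of_split`). [this node] -/
theorem InBaker.abs_of_signed (r : KZ.IntegralRep 1) (F G : (Fin 1 → ℝ) → ℝ)
    (hG : IsSemialgebraicFunOn ℚ r.domain G) (hr : EqOn r.integrand (fun v => F v * |G v|) r.domain)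
    (h : ∀ s : ℚ, (s = 1 ∨ s = -1) → ∀ r' : KZ.IntegralRep 1, r'.domain ⊆ r.domain →
      EqOn r'.integrand (fun v => (s : ℝ) * F v * G v) r'.domain → InBaker (KZ.of r')) :
    InBaker (KZ.of r) := by
  have hSA := r.isSemialgebraic_domain
  have hB : IsSemialgebraic ℚ {v | v ∈ r.domain ∧ G v < 0} := hG.isSemialgebraic_sep_neg
  have hBr : {v | v ∈ r.domain ∧ G v < 0} ⊆ r.domain := fun v hv => hv.1
  have hA : IsSemialgebraic ℚ (r.domain \ {v | v ∈ r.domain ∧ G v < 0}) := hSA.diff hB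
  refine InBaker.of_split r hA hB sdiff_subset hBr (sdiff_union_of_subset hBr).symm
    (by rw [sdiff_inter_self, measure_empty]) ?_ ?_
  · refine h 1 (Or.inl rfl) _ sdiff_subset fun v hv => ?_
    have hv' : v ∈ r.domain := sdiff_subset hv
    have hG0 : 0 ≤ G v := not_lt.1 fun h' => ((mem_sdiff v).1 hv).2 ⟨hv', h'⟩
    show r.integrand v = _
    rw [hr hv']
    beta_reduce
    rw [abs_of_nonneg hG0]
    push_cast
    ring
  · refine h (-1) (Or.inr rfl) _ hBr fun v hv => ?_
    have hv' : v ∈ r.domain := hBr hv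
    have hG0 : G v < 0 := by
      have h' : v ∈ {v | v ∈ r.domain ∧ G v < 0} := hv
      exact h'.2
    show r.integrand v = _
    rw [hr hv']
    beta_reduce
    rw [abs_of_neg hG0]
    push_cast
    ring

/-- **SIGNED CONIC TERMINAL, linear radicand** (`δe = 0`, `δf ≠ 0`): peel `M/R₄`; the rest
`N₁/(R₄√δ) = (N₁/(R₄δ))·√(δf·Y + δg)` is `InBaker.linear_factor`. [this node] -/
theorem InBaker.conic_terminal_signed_lin (W : ConicWall) (γ s : ℚ) (hk : W.k ≠ 0) (he : W.δe = 0)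
    (hf : W.δf ≠ 0) (lo hi : ℚ)
    (hR4 : ∀ x : ℝ, (lo : ℝ) ≤ x → x ≤ hi → Polynomial.aeval x W.R4Y ≠ 0)
    (r : KZ.IntegralRep 1) (hdom : ∀ v ∈ r.domain, (lo : ℝ) ≤ v 0 ∧ v 0 ≤ hi)
    (hδ : ∀ v ∈ r.domain, 0 < W.δ (v 0))
    (hr : EqOn r.integrand (fun v => (γ * s / 3 : ℝ) * W.Λ (v 0) ^ 3 *
      (W.l₀ * W.Λ (v 0) - W.c) / (√(W.δ (v 0)) * (W.Λ (v 0) ^ 2 - W.c))) r.domain) :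
    InBaker (KZ.of r) := by
  refine InBaker.peel_rat (W.MY γ s) W.R4Y lo hi hR4 r hdom
    (fun v => Polynomial.aeval (v 0) (W.N₁Y γ s) / Polynomial.aeval (v 0) W.R4Y /
      √(qD W.δe W.δf W.δg (v 0))) (fun v hv => ?_) fun rB hBd hBi => ?_
  · rw [hr hv]
    beta_reduce
    rw [W.terminal_identity γ s hk (v 0) (hδ v hv) (hR4 _ (hdom v hv).1 (hdom v hv).2)]
    ring
  · have hdomB : ∀ v ∈ rB.domain, v ∈ r.domain := fun v hv => by rwa [hBd] at hv
    refine InBaker.linear_factor W.δf W.δg hf (W.N₁Y γ s) (W.R4Y * W.δY) rB (fun v hv => ?_)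
      fun v hv => ?_
    · rw [map_mul, W.aeval_δY]
      exact mul_ne_zero (hR4 _ (hdom v (hdomB v hv)).1 (hdom v (hdomB v hv)).2)
        (hδ v (hdomB v hv)).ne'
    · have hq : 0 < qD 0 W.δf W.δg (v 0) := by
        rw [← he, ← W.δ_eq_qD]; exact hδ v (hdomB v hv)
      rw [hBi hv]
      beta_reduce
      rw [map_mul, W.aeval_δY, W.δ_eq_qD, he]
      obtain ⟨t, ht⟩ : ∃ t : ℝ, t = √(qD 0 W.δf W.δg (v 0)) := ⟨_, rfl⟩
      have ht0 : t ≠ 0 := by rw [ht]; exact (Real.sqrt_pos.2 hq).ne'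
      have htt : t ^ 2 = qD 0 W.δf W.δg (v 0) := by rw [ht, Real.sq_sqrt hq.le]
      rw [← ht, ← htt]
      field_simp

/-- **CONIC-WALL HEIGHT TERMINAL, linear radicand** (`δe = 0`, `δf ≠ 0`; both branches). [this node] -/
theorem InBaker.conic_height_lin (W : ConicWall) (γ ε : ℚ) (hε : ε = 1 ∨ ε = -1) (hk : W.k ≠ 0)
    (ha : W.a ≠ 0) (hκ : 0 ≤ W.κ₀ ∧ 0 ≤ W.κ₁) (he : W.δe = 0) (hf : W.δf ≠ 0) (lo hi : ℚ)
    (hR4 : ∀ x : ℝ, (lo : ℝ) ≤ x → x ≤ hi → Polynomial.aeval x W.R4Y ≠ 0)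
    (r : KZ.IntegralRep 1) (hdom : ∀ v ∈ r.domain, (lo : ℝ) ≤ v 0 ∧ v 0 ≤ hi)
    (hδ : ∀ v ∈ r.domain, 0 < W.δ (v 0))
    (hr : EqOn r.integrand (BallCube.pheight W.κ₀ W.κ₁ γ W.a W.c (W.Xb ε) (W.Xb' ε)) r.domain) :
    InBaker (KZ.of r) := by
  have hSA := r.isSemialgebraic_domain
  have hΛc : ∀ v ∈ r.domain,
      ((W.P (v 0) + ε * W.l₁ * √(W.δ (v 0))) / W.k) ^ 2 - W.c ≠ 0 := fun v hv =>
    W.Λε_sq_sub_ne ε hε hk (v 0) (hδ v hv).le (hR4 _ (hdom v hv).1 (hdom v hv).2)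
  -- the wall whose `+`-branch is our branch: `W` for `ε = 1`, `W.negl₁` for `ε = -1`
  obtain ⟨W', hk', he', hf', hR4', hδ', hl₀, hc, hΛ'⟩ : ∃ W' : ConicWall, W'.k ≠ 0 ∧ W'.δe = 0 ∧
      W'.δf ≠ 0 ∧ (∀ x : ℝ, (lo : ℝ) ≤ x → x ≤ hi → Polynomial.aeval x W'.R4Y ≠ 0) ∧
      (∀ y, W'.δ y = W.δ y) ∧ W'.l₀ = W.l₀ ∧ W'.c = W.c ∧
      ∀ y, W'.Λ y = (W.P y + ε * W.l₁ * √(W.δ y)) / W.k := by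
    rcases hε with rfl | rfl
    · exact ⟨W, hk, he, hf, hR4, fun y => rfl, rfl, rfl, fun y => by
        simp only [ConicWall.Λ]; push_cast; ring⟩
    · exact ⟨W.negl₁, by rwa [W.negl₁_k], by rw [W.negl₁_δe, he], by rwa [W.negl₁_δf],
        fun x h₁ h₂ => by rw [W.negl₁_R4Y]; exact hR4 x h₁ h₂, W.negl₁_δ, rfl, rfl, fun y => by
        rw [W.negl₁_Λ]; push_cast; ring⟩
  refine InBaker.abs_of_signed r
    (fun v => (γ / 3 : ℝ) / (√(W'.δ (v 0)) * (W'.Λ (v 0) ^ 2 - W'.c)))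
    (fun v => W'.Λ (v 0) ^ 3 * (W'.l₀ * W'.Λ (v 0) - W'.c)) ?_ (fun v hv => ?_)
    fun s hs r' hsub hr' => ?_
  · have hΛ := W'.isSemialgebraicFunOn_Λ hSA
    exact ((hΛ.mul_holds (hΛ.mul_holds hΛ)).mul_holds
      (((isSemialgebraicFunOn_ratCast hSA W'.l₀).mul_holds hΛ).sub_holds
        (isSemialgebraicFunOn_ratCast hSA W'.c))).congr fun v _ => by
      simp only [Pi.mul_apply, Pi.sub_apply]; ring
  · rw [hr hv]
    beta_reduce
    rw [W.pheight_Xb γ ε hε hk ha hκ v (hδ v hv) (hΛc v hv), ← hΛ', hδ', hl₀, hc]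
    ring
  · refine InBaker.conic_terminal_signed_lin W' γ s hk' he' hf' lo hi hR4' r'
      (fun v hv => hdom v (hsub hv)) (fun v hv => by rw [hδ']; exact hδ v (hsub hv))
      fun v hv => ?_
    rw [hr' hv]
    beta_reduce
    ring

/-! #### 36.7 The stratum `k = 0`: a rational branch -/

namespace ConicWall

variable (W : ConicWall)

/-- For `k = 0` the wall `a(κ₀X² + κ₁Y²) + c = (L + l₁X)²` is linear in `X`; its graph
`X(Y) = (aκ₁Y² + c − L(Y)²)/(2l₁L(Y))`. -/
def Xr (y : ℝ) : ℝ := (W.a * W.κ₁ * y ^ 2 + W.c - W.L y ^ 2) / (2 * W.l₁ * W.L y)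

/-- Its derivative. -/
def Xr' (y : ℝ) : ℝ :=
  ((2 * W.a * W.κ₁ * y - 2 * W.l₂ * W.L y) * (2 * W.l₁ * W.L y) -
    (W.a * W.κ₁ * y ^ 2 + W.c - W.L y ^ 2) * (2 * W.l₁ * W.l₂)) / (2 * W.l₁ * W.L y) ^ 2

/-- Auxiliary step `hasDerivAt_Xr`. [bookkeeping] -/
theorem hasDerivAt_Xr (y : ℝ) (hL : W.L y ≠ 0) (hl₁ : W.l₁ ≠ 0) :
    HasDerivAt W.Xr (W.Xr' y) y := by
  have hl : (W.l₁ : ℝ) ≠ 0 := by exact_mod_cast hl₁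
  have hLd : HasDerivAt (fun x : ℝ => (W.l₀ : ℝ) + W.l₂ * x) (W.l₂ : ℝ) y := by
    simpa using ((hasDerivAt_id' y).const_mul (W.l₂ : ℝ)).const_add (W.l₀ : ℝ)
  have hN : HasDerivAt (fun x : ℝ => (W.a : ℝ) * W.κ₁ * x ^ 2 + W.c - (W.l₀ + W.l₂ * x) ^ 2)
      (2 * W.a * W.κ₁ * y - 2 * W.l₂ * W.L y) y := by
    have h := (((hasDerivAt_pow 2 y).const_mul ((W.a : ℝ) * W.κ₁)).add_const (W.c : ℝ)).sub
      (hLd.pow 2)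
    exact h.congr_deriv (by simp only [ConicWall.L]; push_cast; ring)
  have hD : HasDerivAt (fun x : ℝ => 2 * (W.l₁ : ℝ) * (W.l₀ + W.l₂ * x)) (2 * W.l₁ * W.l₂) y :=
    (hLd.const_mul (2 * (W.l₁ : ℝ))).congr_deriv (by ring)
  have hD0 : 2 * (W.l₁ : ℝ) * (W.l₀ + W.l₂ * y) ≠ 0 :=
    mul_ne_zero (mul_ne_zero two_ne_zero hl) hL
  exact (hN.div hD hD0).congr_deriv (by simp only [Xr', ConicWall.L])

/-- Auxiliary step `isRatOn_Xr`. [bookkeeping] -/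
theorem isRatOn_Xr {T : Set (Fin 1 → ℝ)} (hL : ∀ v ∈ T, W.L (v 0) ≠ 0) (hl₁ : W.l₁ ≠ 0) :
    IsRatOn T fun v => W.Xr (v 0) := by
  have hl : (W.l₁ : ℝ) ≠ 0 := by exact_mod_cast hl₁
  have hLr : IsRatOn T fun v => W.L (v 0) :=
    ((IsRatOn.const W.l₀).add ((IsRatOn.const W.l₂).mul IsRatOn.coord)).congr fun v _ => by
      simp [ConicWall.L]
  exact ((((IsRatOn.const (W.a * W.κ₁)).mul (IsRatOn.coord.pow 2)).add (IsRatOn.const W.c)).sub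
    (hLr.pow 2)).div ((IsRatOn.const (2 * W.l₁)).mul hLr) (fun v hv => by
      push_cast; exact mul_ne_zero (mul_ne_zero two_ne_zero hl) (hL v hv)) |>.congr
    fun v _ => by simp only [Xr]; push_cast; ring

/-- Auxiliary step `isRatOn_Xr'`. [bookkeeping] -/
theorem isRatOn_Xr' {T : Set (Fin 1 → ℝ)} (hL : ∀ v ∈ T, W.L (v 0) ≠ 0) (hl₁ : W.l₁ ≠ 0) :
    IsRatOn T fun v => W.Xr' (v 0) := by
  have hl : (W.l₁ : ℝ) ≠ 0 := by exact_mod_cast hl₁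
  have hLr : IsRatOn T fun v => W.L (v 0) :=
    ((IsRatOn.const W.l₀).add ((IsRatOn.const W.l₂).mul IsRatOn.coord)).congr fun v _ => by
      simp [ConicWall.L]
  have hN : IsRatOn T fun v =>
      (2 * (W.a : ℝ) * W.κ₁ * v 0 - 2 * W.l₂ * W.L (v 0)) * (2 * W.l₁ * W.L (v 0)) -
        (W.a * W.κ₁ * v 0 ^ 2 + W.c - W.L (v 0) ^ 2) * (2 * W.l₁ * W.l₂) :=
    (((((IsRatOn.const (2 * W.a * W.κ₁)).mul IsRatOn.coord).sub
      ((IsRatOn.const (2 * W.l₂)).mul hLr)).mul ((IsRatOn.const (2 * W.l₁)).mul hLr)).sub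
      (((((IsRatOn.const (W.a * W.κ₁)).mul (IsRatOn.coord.pow 2)).add (IsRatOn.const W.c)).sub
        (hLr.pow 2)).mul (IsRatOn.const (2 * W.l₁ * W.l₂)))).congr fun v _ => by
      push_cast; ring
  have hD : IsRatOn T fun v => (2 * (W.l₁ : ℝ) * W.L (v 0)) ^ 2 :=
    (((IsRatOn.const (2 * W.l₁)).mul hLr).pow 2).congr fun v _ => by push_cast; ring
  exact (hN.div hD fun v hv => pow_ne_zero 2 (mul_ne_zero (mul_ne_zero two_ne_zero hl)
    (hL v hv))).congr fun v _ => by simp only [Xr']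

/-- For `k = 0` the rational branch lies on the wall: `a(κ₀X² + κ₁Y²) + c = (L + l₁X)²`. -/
theorem Xr_wall (hk : W.k = 0) (hl₁ : W.l₁ ≠ 0) (y : ℝ) (hL : W.L y ≠ 0) :
    W.a * (W.κ₀ * W.Xr y ^ 2 + W.κ₁ * y ^ 2) + W.c = (W.L y + W.l₁ * W.Xr y) ^ 2 := by
  have hl : (W.l₁ : ℝ) ≠ 0 := by exact_mod_cast hl₁
  have hk' : (W.a : ℝ) * W.κ₀ = W.l₁ ^ 2 := by
    have h : ((W.a * W.κ₀ - W.l₁ ^ 2 : ℚ) : ℝ) = 0 := by exact_mod_cast hk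
    push_cast at h
    linarith
  have hX : 2 * (W.l₁ : ℝ) * W.L y * W.Xr y = W.a * W.κ₁ * y ^ 2 + W.c - W.L y ^ 2 := by
    simp only [Xr]
    field_simp
  linear_combination (W.Xr y ^ 2) * hk' - hX

/-- … and `X − YX′` is rational (no identity needed beyond the definitions). -/
theorem pheight_Xr (γ : ℚ) (hk : W.k = 0) (hl₁ : W.l₁ ≠ 0) (ha : W.a ≠ 0)
    (hκ : 0 ≤ W.κ₀ ∧ 0 ≤ W.κ₁) (v : Fin 1 → ℝ) (hL : W.L (v 0) ≠ 0)
    (hpos : 0 < W.Xr (v 0)) :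
    BallCube.pheight W.κ₀ W.κ₁ γ W.a W.c W.Xr W.Xr' v =
      (γ / 3 : ℝ) * ((W.L (v 0) + W.l₁ * W.Xr (v 0)) ^ 2 /
        ((W.L (v 0) + W.l₁ * W.Xr (v 0)) ^ 2 - W.c)) *
        |(W.L (v 0) + W.l₁ * W.Xr (v 0)) * (W.Xr (v 0) - v 0 * W.Xr' (v 0))| := by
  have ha0 : (W.a : ℝ) ≠ 0 := by exact_mod_cast ha
  have hwall := W.Xr_wall hk hl₁ (v 0) hL
  set t := W.L (v 0) + (W.l₁ : ℝ) * W.Xr (v 0) with ht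
  clear_value t
  have hρ0 : 0 < (W.κ₀ : ℝ) * W.Xr (v 0) ^ 2 + W.κ₁ * v 0 ^ 2 := by
    have hκ₀ : (0 : ℝ) < W.κ₀ := by
      have h : (W.a : ℝ) * W.κ₀ = W.l₁ ^ 2 := by
        have h : ((W.a * W.κ₀ - W.l₁ ^ 2 : ℚ) : ℝ) = 0 := by exact_mod_cast hk
        push_cast at h
        linarith
      have hl : (W.l₁ : ℝ) ≠ 0 := by exact_mod_cast hl₁
      rcases (show (0 : ℝ) ≤ W.κ₀ by exact_mod_cast hκ.1).eq_or_lt with h0 | h0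
      · exact absurd h (by rw [← h0, mul_zero]; exact (pow_ne_zero 2 hl).symm)
      · exact h0
    exact add_pos_of_pos_of_nonneg (mul_pos hκ₀ (pow_pos hpos 2))
      (mul_nonneg (by exact_mod_cast hκ.2) (sq_nonneg _))
  have hρ : (W.κ₀ : ℝ) * W.Xr (v 0) ^ 2 + W.κ₁ * v 0 ^ 2 = (t ^ 2 - W.c) / W.a := by
    rw [eq_div_iff ha0]
    linear_combination hwall
  have htc : t ^ 2 - (W.c : ℝ) ≠ 0 := by
    intro h
    rw [h, zero_div] at hρ
    exact hρ0.ne' hρ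
  simp only [BallCube.pheight, BallCube.ph]
  rw [Real.sq_sqrt hρ0.le, hwall, Real.sqrt_sq_eq_abs, hρ, abs_mul t]
  field_simp

end ConicWall

/-- **CONIC-WALL HEIGHT TERMINAL, stratum `k = 0`.**  On a domain where `L ≠ 0`, `X(Y) > 0` and
`(L + l₁X)² ≠ c` the height integrand along the rational branch is a rational function times the
absolute value of a rational function: one sign split (`InBaker.abs_of_signed`) and `InBaker.of_isRatOn`.
[this node] -/
theorem InBaker.conic_height_k0 (W : ConicWall) (γ : ℚ) (hk : W.k = 0) (hl₁ : W.l₁ ≠ 0)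
    (ha : W.a ≠ 0) (hκ : 0 ≤ W.κ₀ ∧ 0 ≤ W.κ₁) (r : KZ.IntegralRep 1)
    (hL : ∀ v ∈ r.domain, W.L (v 0) ≠ 0) (hpos : ∀ v ∈ r.domain, 0 < W.Xr (v 0))
    (hc : ∀ v ∈ r.domain, (W.L (v 0) + W.l₁ * W.Xr (v 0)) ^ 2 - W.c ≠ 0)
    (hr : EqOn r.integrand (BallCube.pheight W.κ₀ W.κ₁ γ W.a W.c W.Xr W.Xr') r.domain) :
    InBaker (KZ.of r) := by
  have hSA := r.isSemialgebraic_domain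
  have hX := W.isRatOn_Xr hL hl₁
  have hX' := W.isRatOn_Xr' hL hl₁
  have hLr : IsRatOn r.domain fun v => W.L (v 0) :=
    ((IsRatOn.const W.l₀).add ((IsRatOn.const W.l₂).mul IsRatOn.coord)).congr fun v _ => by
      simp [ConicWall.L]
  have hΛ : IsRatOn r.domain fun v => W.L (v 0) + W.l₁ * W.Xr (v 0) :=
    hLr.add ((IsRatOn.const W.l₁).mul hX)
  have hF : IsRatOn r.domain fun v => (γ / 3 : ℝ) * ((W.L (v 0) + W.l₁ * W.Xr (v 0)) ^ 2 /
      ((W.L (v 0) + W.l₁ * W.Xr (v 0)) ^ 2 - W.c)) :=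
    ((IsRatOn.const (γ / 3)).mul ((hΛ.pow 2).div ((hΛ.pow 2).sub (IsRatOn.const W.c)) hc)).congr
      fun v _ => by push_cast; ring
  have hG : IsRatOn r.domain fun v =>
      (W.L (v 0) + W.l₁ * W.Xr (v 0)) * (W.Xr (v 0) - v 0 * W.Xr' (v 0)) :=
    hΛ.mul (hX.sub (IsRatOn.coord.mul hX'))
  refine InBaker.abs_of_signed r
    (fun v => (γ / 3 : ℝ) * ((W.L (v 0) + W.l₁ * W.Xr (v 0)) ^ 2 /
      ((W.L (v 0) + W.l₁ * W.Xr (v 0)) ^ 2 - W.c)))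
    (fun v => (W.L (v 0) + W.l₁ * W.Xr (v 0)) * (W.Xr (v 0) - v 0 * W.Xr' (v 0)))
    (hG.isSemialgebraicFunOn hSA) (fun v hv => ?_) fun s hs r' hsub hr' => ?_
  · rw [hr hv]
    exact W.pheight_Xr γ hk hl₁ ha hκ v (hL v hv) (hpos v hv)
  · exact InBaker.of_isRatOn r' (((IsRatOn.const s).mul (hF.mono hsub)).mul (hG.mono hsub)) hr'

end Summit.KontsevichZagierPeriods.RootDecompWalshStrata.ConicDescent

end
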